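import Summits.ABC.IUTFork.Joshi.LogLinkColumn
import Mathlib.RingTheory.Ideal.Quotient.Operations

/-!
# [J-IIp] §10.13–§10.15: the Frobenius transport of residue fields along a log-link, and the READING FORK it opens in
# Thm. 10.15.1 (3)/(4) — located in kernel, not adjudicated

Block E, seat abc-iut-E-t7 (fallback claim J2p §10, APPROVED by E-plan-2 07:13:52Z), over E-t3's period-ring signature
`PeriodRingDatum` (`Joshi/ThetaValuesLocus.lean`, p427971) and E-t3's `Joshi/LogLinkColumn.lean` (p429867), whose decls
(`Bphi`, `NoCommutingFieldIso`, `commuting_iso_apply`, `column`, …) are used BY NAME. Source: K. Joshi, arXiv:2303.01662v3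
(`paper:arxiv-2303.01662`, render `HOME/lit/renders/Joshi-arxiv-2303.01662/pNNNN.txt`, «p.N l.M»; bib `Joshi2023ATS2Local`;
unrefereed — TYPED AS A CANDIDATE). TAKES NO SIDE on [IUTchIII] Cor. 3.12, on Joshi's claims, or on Mochizuki's reports on
them; typed ≠ proved; a located reading fork is NOT a verdict on any author (E-PLAN R8/R13: double-read by E-ref / E-cx).

WHAT PRINT SAYS. §10.13 (p.33 l.1–12): along the fibre `y_n = ϕ(y_{n−1})` over `x_can`, «`ϕ(𝔪_{y_{n−1}}) = 𝔪_{ϕ(y_{n−1})} = 𝔪_{y_n}`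
… `ϕ([a] − p) = [a^p] − p` generates the prime ideal corresponding to `ϕ(y_{n−1}) = y_n`». §10.14 (p.33 l.13–17): «one has an
isomorphism `K_{x_can} ≃ K_{y_n}` for all `n` [FF18, Thm. 6.5.2 (5)]. So one has a natural identification `K_{y_n} ≃ ℂ_p`.»
§10.15 (p.33 l.18–23): «each `y_n` represents a distinct pair `(K_{y_n}, K^♭_{y_n} ≃ ℂ_p^♭)` notably the fields `K_{y_n} = ℂ_p` is
fixed, but the tilting data … is not fixed». Thm. 10.15.1 (3) (p.33 l.66–68): «There is no continuous field isomorphism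
`ℂ_p = K_{y_{n−1}} ≃ K_{x_can} → K_{y_n} ≃ K_{x_can} = ℂ_p` which may be inserted into the middle row of the diagram so that each
resulting square commutes»; proof (l.75–77): «ℂ_p cannot be equipped with any field homomorphism of the sort `x ↦ x^p` which
would be forced by commutativity». (4) (l.69–70): «log(˜1+𝔪_{y_{n−1}}) ⊂ p·log(˜1+𝔪_{y_n})», proof «log([1+x]^p) = p·log([1+x])».

WHAT THIS FILE RECORDS (kernel, over explicit hypotheses; nothing asserted).
* §1 `FrobeniusTransport D y` — the HONEST INPUTS of §10.13 at a point `y`: `ϕ` is a ring endomorphism of `B` ([FF18]; E-t3's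
  `frob` is that map), `η_{K_y}` and `η_{K_{ϕ(y)}} ∘ ϕ` are surjective (§10.5 «canonical surjection»), and
  `ker(η_{K_{ϕ(y)}} ∘ ϕ) = ker η_{K_y}` (= §10.13's «`ϕ(𝔪_y) = 𝔪_{ϕ(y)}`»). From them the first isomorphism theorem BUILDS
  `residueIso : K_y ≃+* K_{ϕ(y)}` with `residueIso (η_y b) = η_{ϕ(y)} (ϕ b)` for ALL `b ∈ B` (`residueIso_eta`).
* §2 CONSEQUENCE for E-t3's AS-PRINTED typing `PeriodRingDatum.NoCommutingFieldIso y` («no ring iso `K_y ≃ K_{ϕ(y)}` commuting with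
  `η` and `ϕ` on `B^{φ=p}`»): it FAILS under §10.13's own transport (`not_noCommutingFieldIso_of_transport`) — the square of
  Thm. 10.15.1 (2) COMMUTES with `residueIso` inserted. LOCATED: either print's (3) carries more than the middle-row square
  (the bottom identifications `K_{y_n} ≃ K_{x_can} = ℂ_p`), or it is inconsistent with §10.13; no verdict here.
* §3 The COMMON-TARGET form of (3) (both residue fields identified with one field `C` = «`K_{x_can} = ℂ_p`», structure
  `CommonTarget`), and the two candidate readings of §10.14–§10.15 as `Prop`s: (R-ϕ) `FrobCompatible` — the identifications are
  transported along `ϕ` ([FF18] Thm. 6.5.2 (5)'s construction); (R-fix) `LogsCoincide` — «the field `K_{y_n} = ℂ_p` is fixed» read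
  as: the two logarithms `B^{φ=p} → C` are the same map. KERNEL: (R-fix) + «log hits 1» ⟹ (3) HOLDS (`noInsertedIso_of_logsCoincide`,
  Joshi's argument verbatim: `τ(1) = p`); (R-ϕ) ⟹ (3) FAILS with `τ = id` (`not_noInsertedIso_of_frobCompatible`); hence the two
  readings are jointly inconsistent (`logsCoincide_frobCompatible_absurd`). And (4) is DERIVED in reading (R-ϕ)
  (`logShellStep_of_frobCompatible`: `log_{n−1}(b) = p·log_n(b)` after transport), where (3) fails.
Continuity is not modelled (no topology in the signature): the typed (3) quantifies over ALL ring isomorphisms, so it is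
STRONGER than print as a negative and its refutation by an explicit algebraic `τ` is WEAKER than a refutation of print unless
that `τ` is continuous — under (R-ϕ) `τ = id`. Flagged for the faithfulness lane; located, not adjudicated.

OUR nearest objects (recorded, not bound — R14): the vertical column of log-links and (Ind3) (`Thm311.Column`,
`Column.frobΨ m`, upper semi-compatibility of log-shells «shell at m−1 inside the shell at m up to p»); E-t18's global
`RosettaIndDatum.KummerShift` / `CanonicalInd3` and dictionary row D-07 (`DictionaryIndeterminacies.LogLinkIsColumnStep`).
-/

noncomputable section

open Set

namespace Summit.ABC.IUTFork.Joshi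

namespace PeriodRingDatum

variable {F B E0 : Type} [Field F] [CommRing B] [Field E0] {Y : Type} {K : Y → Type} [∀ y, Field (K y)] {G : Type}
  (D : PeriodRingDatum F B E0 Y K G)

/-! ## 1. §10.13: the Frobenius transport of residue fields -/

/-- **The honest inputs of §10.13 at a point `y`** (p.33 l.1–12 «`ϕ(𝔪_{y_{n−1}}) = 𝔪_{y_n}`»; §10.5 p.31 l.40–45 «canonical
surjection `η_{K_y}`»; [FF18]: `ϕ` is a ring endomorphism of `B`). HYPOTHESIS structure over E-t3's signature (whose `frob` is
a bare map and whose `eta` carries no surjectivity), nothing asserted. [claim: Joshi2023ATS2Local, status: disputed] -/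
structure FrobeniusTransport (y : Y) where
  /-- `ϕ : B → B` as a ring homomorphism -/
  frobHom : B →+* B
  /-- … it IS the signature's Frobenius -/
  frobHom_eq : ∀ b : B, frobHom b = D.frob b
  /-- `η_{K_y} : B → K_y` is surjective (§10.5) -/
  eta_surj : Function.Surjective (D.eta y)
  /-- `η_{K_{ϕ(y)}} ∘ ϕ : B → K_{ϕ(y)}` is surjective -/
  eta_frob_surj : Function.Surjective ((D.eta (D.frobY y)).comp frobHom)
  /-- §10.13: `ϕ(𝔪_y) = 𝔪_{ϕ(y)}`, as `ker(η_{ϕ(y)} ∘ ϕ) = ker η_y` -/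
  ker_eq : RingHom.ker ((D.eta (D.frobY y)).comp frobHom) = RingHom.ker (D.eta y)

namespace FrobeniusTransport

variable {D} {y : Y} (T : D.FrobeniusTransport y)

/-- **The Frobenius-induced residue isomorphism `σ_y : K_y ≃+* K_{ϕ(y)}`** — `K_y ≅ B/𝔪_y = B/ker(η_{ϕ(y)} ∘ ϕ) ≅ K_{ϕ(y)}`
(first isomorphism theorem twice and §10.13's equality of kernels). CONSTRUCTED, not posited. [folklore] -/
def residueIso : K y ≃+* K (D.frobY y) :=
  ((RingHom.quotientKerEquivOfSurjective T.eta_surj).symm.trans (Ideal.quotEquivOfEq T.ker_eq.symm)).trans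
    (RingHom.quotientKerEquivOfSurjective T.eta_frob_surj)

/-- `σ_y (η_y b) = η_{ϕ(y)} (ϕ b)` for every `b ∈ B`: the square «`η` then `σ_y`» = «`ϕ` then `η`» commutes on ALL of `B`.
[folklore] -/
theorem residueIso_eta (b : B) : T.residueIso (D.eta y b) = D.eta (D.frobY y) (D.frob b) := by
  rw [← T.frobHom_eq b]
  simp [residueIso, Ideal.quotEquivOfEq_mk]

end FrobeniusTransport

/-! ## 2. Consequence for the AS-PRINTED typing of Thm. 10.15.1 (3) -/

/-- **LOCATED (for the faithfulness lane, no verdict):** under §10.13's Frobenius transport, E-t3's as-printed typing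
`NoCommutingFieldIso y` of Thm. 10.15.1 (3) («no ring isomorphism `K_y ≃ K_{ϕ(y)}` with `f (η_y b) = η_{ϕ(y)} (ϕ b)` on `B^{φ=p}`»)
FAILS: `σ_y = residueIso` is such an isomorphism (it commutes even on all of `B`). So print's (3) must carry content beyond the
middle-row square — the bottom identifications `K_{y_n} ≃ K_{x_can} = ℂ_p`, see §3 — or be read against §10.13.
[claim: Joshi2023ATS2Local, status: disputed] -/
theorem not_noCommutingFieldIso_of_transport {y : Y} (T : D.FrobeniusTransport y) : ¬ D.NoCommutingFieldIso y :=
  fun h => h ⟨T.residueIso, fun b _ => T.residueIso_eta b⟩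

/-- What `σ_y` does on the logarithms (`b ∈ B^{φ=p}`, where `ϕ b = p·b`): `σ_y (η_y b) = p · η_{ϕ(y)} b` — the additive form of
print's «field homomorphism of the sort `x ↦ x^p`» (E-t3's `commuting_iso_apply`, instantiated). [folklore] -/
theorem residueIso_eta_of_mem_Bphi {y : Y} (T : D.FrobeniusTransport y) {b : B} (hb : b ∈ D.Bphi) :
    T.residueIso (D.eta y b) = (D.p : K (D.frobY y)) * D.eta (D.frobY y) b :=
  D.commuting_iso_apply T.residueIso (fun b _ => T.residueIso_eta b) hb

/-! ## 3. The common-target form of Thm. 10.15.1 (3)/(4) and the reading fork (R-ϕ) / (R-fix) -/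

/-- **§10.14 «natural identification `K_{y_n} ≃ ℂ_p`»** at the two ends of one log-link `y ↦ ϕ(y)`: both residue fields
identified with ONE field `C` (= `K_{x_can} = ℂ_p`, [FF18 Thm. 6.5.2 (5)]). DATA only; which identifications are meant is the
reading fork below. [claim: Joshi2023ATS2Local, status: disputed] -/
structure CommonTarget (C : Type) [Field C] (y : Y) where
  /-- `K_y ≃ K_{x_can} = C` -/
  iso₀ : K y ≃+* C
  /-- `K_{ϕ(y)} ≃ K_{x_can} = C` -/
  iso₁ : K (D.frobY y) ≃+* C

variable {D} {C : Type} [Field C]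

/-- The logarithm of `y` read in `C`: `b ↦ iso₀ (η_y b)` (on `B^{φ=p}` this is «`log`», §10.5). [claim: Joshi2023ATS2Local, status: disputed] -/
def CommonTarget.log₀ {y : Y} (I : D.CommonTarget C y) (b : B) : C := I.iso₀ (D.eta y b)

/-- The logarithm of `ϕ(y)` read in `C`: `b ↦ iso₁ (η_{ϕ(y)} b)`. [claim: Joshi2023ATS2Local, status: disputed] -/
def CommonTarget.log₁ {y : Y} (I : D.CommonTarget C y) (b : B) : C := I.iso₁ (D.eta (D.frobY y) b)

/-- **Reading (R-ϕ)**: the identifications with `C` are transported along `ϕ` — `iso₁ ∘ σ_y = iso₀` ([FF18] Thm. 6.5.2 (5)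
identifies the residue fields over one point of `X = Y/ϕ^ℤ` through `ϕ` itself). OUR READING, candidate. [claim: Joshi2023ATS2Local, status: disputed] -/
@[claim "Joshi2023ATS2Local" "disputed"]
def FrobCompatible {y : Y} (T : D.FrobeniusTransport y) (I : D.CommonTarget C y) : Prop :=
  ∀ k : K y, I.iso₁ (T.residueIso k) = I.iso₀ k

/-- **Reading (R-fix)**: «the fields `K_{y_n} = ℂ_p` is fixed» (§10.15 p.33 l.21) read as: the two logarithms
`B^{φ=p} → C` are literally the same map. OUR READING of the sentence print's proof of (3) uses, candidate.
[claim: Joshi2023ATS2Local, status: disputed] -/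
@[claim "Joshi2023ATS2Local" "disputed"]
def LogsCoincide {y : Y} (I : D.CommonTarget C y) : Prop := ∀ b ∈ D.Bphi, I.log₀ b = I.log₁ b

/-- **Thm. 10.15.1 (3) in common-target form** (p.33 l.66–68): no field automorphism `τ` of `C = ℂ_p` inserted in the middle row
makes the square commute, i.e. none satisfies `τ (log₀ b) = log₁ (ϕ b)` on `B^{φ=p}`. Continuity NOT modelled (typed over all
ring automorphisms: stronger than print as a negative). Joshi's CLAIM, typed; never asserted. [claim: Joshi2023ATS2Local, status: disputed] -/
@[claim "Joshi2023ATS2Local" "disputed"]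
def NoInsertedIso {y : Y} (I : D.CommonTarget C y) : Prop :=
  ¬ ∃ τ : C ≃+* C, ∀ b ∈ D.Bphi, τ (I.log₀ b) = I.log₁ (D.frob b)

/-- On `B^{φ=p}` the right-hand side of the square is `p · log₁ b` («`log([1+x]^p) = p·log([1+x])`», p.33 l.77). [folklore] -/
theorem CommonTarget.log₁_frob {y : Y} (I : D.CommonTarget C y) {b : B} (hb : b ∈ D.Bphi) :
    I.log₁ (D.frob b) = (D.p : C) * I.log₁ b := by
  unfold CommonTarget.log₁
  rw [show D.frob b = (D.p : B) * b from hb, map_mul, map_natCast, map_mul, map_natCast]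

/-- **(R-fix) ⟹ (3) HOLDS — Joshi's argument, verbatim in kernel**: if the two logarithms coincide and the logarithm hits `1`
(§10.5: `log : B^{φ=p} → K` is surjective), an inserted `τ` would satisfy `τ(1) = p·1`, impossible for a ring isomorphism when
`p ≠ 1` in `C` (e.g. `C` of characteristic `0`). [claim: Joshi2023ATS2Local, status: disputed] -/
theorem noInsertedIso_of_logsCoincide {y : Y} (I : D.CommonTarget C y) (hfix : LogsCoincide I)
    (hone : ∃ b ∈ D.Bphi, D.eta (D.frobY y) b = 1) (hp : (D.p : C) ≠ 1) : NoInsertedIso I := by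
  rintro ⟨τ, hτ⟩
  obtain ⟨b, hb, hb1⟩ := hone
  have h1 : I.log₁ b = 1 := by simp [CommonTarget.log₁, hb1]
  have h := hτ b hb
  rw [hfix b hb, I.log₁_frob hb, h1, mul_one, map_one] at h
  exact hp h.symm

/-- **(R-ϕ) ⟹ (3) FAILS**: with the identifications transported along `ϕ`, the IDENTITY of `C` makes every square commute
(`log₁ (ϕ b) = iso₁ (σ_y (η_y b)) = iso₀ (η_y b) = log₀ b`). Located, not adjudicated. [claim: Joshi2023ATS2Local, status: disputed] -/
theorem not_noInsertedIso_of_frobCompatible {y : Y} (T : D.FrobeniusTransport y) (I : D.CommonTarget C y)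
    (hI : FrobCompatible T I) : ¬ NoInsertedIso I := by
  intro h
  refine h ⟨RingEquiv.refl C, fun b _ => ?_⟩
  show I.iso₀ (D.eta y b) = I.iso₁ (D.eta (D.frobY y) (D.frob b))
  rw [← T.residueIso_eta b, hI]

/-- **The two readings are jointly inconsistent** (given that the logarithm hits `1` and `p ≠ 1` in `C`): under (R-ϕ) the
logarithms differ by the factor `p` after transport, so they cannot coincide. Kernel bookkeeping for the faithfulness lane.
[claim: Joshi2023ATS2Local, status: disputed] -/
theorem logsCoincide_frobCompatible_absurd {y : Y} (T : D.FrobeniusTransport y) (I : D.CommonTarget C y)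
    (hI : FrobCompatible T I) (hfix : LogsCoincide I) (hone : ∃ b ∈ D.Bphi, D.eta (D.frobY y) b = 1)
    (hp : (D.p : C) ≠ 1) : False :=
  not_noInsertedIso_of_frobCompatible T I hI (noInsertedIso_of_logsCoincide I hfix hone hp)

/-- Under (R-ϕ) the two logarithms differ by `p`: `log₀ b = p · log₁ b` on `B^{φ=p}` — print's «`log([1+x]^p) = p·log([1+x])`»
read through the transport. [claim: Joshi2023ATS2Local, status: disputed] -/
theorem log₀_eq_p_mul_log₁_of_frobCompatible {y : Y} (T : D.FrobeniusTransport y) (I : D.CommonTarget C y)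
    (hI : FrobCompatible T I) {b : B} (hb : b ∈ D.Bphi) : I.log₀ b = (D.p : C) * I.log₁ b := by
  rw [← I.log₁_frob hb]
  show I.iso₀ (D.eta y b) = I.iso₁ (D.eta (D.frobY y) (D.frob b))
  rw [← T.residueIso_eta b, hI]

/-- **Thm. 10.15.1 (4) in common-target form** (p.33 l.69–70): «for Mochizuki style log-shells one has
`log(˜1+𝔪_{y_{n−1}}) ⊂ p·log(˜1+𝔪_{y_n})`» — the image of `B^{φ=p}` under `log₀` (the shell of `y = y_{n−1}`) lies in `p`
times the image under `log₁` (the shell of `ϕ(y) = y_n`). Joshi's CLAIM, typed; never asserted. [claim: Joshi2023ATS2Local, status: disputed] -/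
@[claim "Joshi2023ATS2Local" "disputed"]
def LogShellStep {y : Y} (I : D.CommonTarget C y) : Prop :=
  I.log₀ '' D.Bphi ⊆ (fun c => (D.p : C) * c) '' (I.log₁ '' D.Bphi)

/-- **(4) DERIVED in reading (R-ϕ)** (where (3) fails): immediate from `log₀ = p · log₁` on `B^{φ=p}`.
[claim: Joshi2023ATS2Local, status: disputed] -/
theorem logShellStep_of_frobCompatible {y : Y} (T : D.FrobeniusTransport y) (I : D.CommonTarget C y)
    (hI : FrobCompatible T I) : LogShellStep I := by
  rintro _ ⟨b, hb, rfl⟩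
  exact ⟨I.log₁ b, ⟨b, hb, rfl⟩, (log₀_eq_p_mul_log₁_of_frobCompatible T I hI hb).symm⟩

/-- **(4) whenever the logarithm of `ϕ(y)` is surjective onto `C`** (§10.5; e.g. in reading (R-fix), where (4) reads `L ⊆ p·L`
for the one shell `L = C`): then `p·(shell of ϕ(y)) = C` contains everything, given `p ≠ 0` in `C`. Recorded for completeness —
under surjectivity (4) carries no information. [claim: Joshi2023ATS2Local, status: disputed] -/
theorem logShellStep_of_log₁_surjective {y : Y} (I : D.CommonTarget C y)
    (hsurj : ∀ c : C, ∃ b ∈ D.Bphi, I.log₁ b = c) (hp : (D.p : C) ≠ 0) : LogShellStep I := by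
  rintro _ ⟨b, hb, rfl⟩
  obtain ⟨b', hb', h'⟩ := hsurj ((D.p : C)⁻¹ * I.log₀ b)
  exact ⟨I.log₁ b', ⟨b', hb', rfl⟩, by simp only [h', ← mul_assoc, mul_inv_cancel₀ hp, one_mul]⟩

end PeriodRingDatum

end Summit.ABC.IUTFork.Joshi

end
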